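import Summits.CriticalPhenomena.PercolationContinuityZ3.Theorems.Transplant.TwoAxisParaCellsFineFrame
import HarnessLib

/-!
# N1 ({±1} node), (F) column / kit adapter (hp-8 g33): the face frame is COMPATIBLE WITH φ-BOXES — planar positions within `n` of each other in
# both coordinates have frame points within `n` (hence `n + 1`) in both frame coordinates: the `hcomp` hypothesis of p1-g11's `kitClauseA` for the
# window map `ψ := pr.frame φ t I b` (from `c_I·L_I ≤ D`), together with the same fact for the cell map `pr.ψ φ t` (`fine_containment` at `s = k = n`)

builds on p205010 (kernel theorem, internal audit signed; external expert review pending) — nothing in this file uses p205010; planar arithmetic only.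
Lane `prim-bschramm`, seat `prim-hp-8` (gen 33); helper file (`--supports stmt-CriticalPhenomena-4575 --as helper`).
* `FinePrm.ψ_comp` (`|φ v i − φ w i| ≤ n ⇒ |ψ v i − ψ w i| ≤ n`, both axes, `c_i L_i ≤ D`), **`FinePrm.frame_comp`** (`φ v − φ w ∈ box 2 n ⇒ |frame v i − frame w i| ≤ n + 1`,
  the literal `hcomp` shape), `FinePrm.frame_comp'` (the sharper `≤ n`).
[cite: KozmaNitzan2024, §4 Lemma 10 Step IV (p. 21: Q ⊆ S)] [cite: MartineauTassion2017, §4.1]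
-/

namespace Summit.CriticalPhenomena.PercolationContinuityZ3.Theorems.Transplant

namespace Skelφ

open Literature.Probability.LatticeModels
open Literature.Probability.Percolation.KozmaNitzan.Cells (oth oth_ne eq_oth_of_ne oth_oth)

namespace FinePrm

variable {V : Type} {φ : V → Site 2} (pr : FinePrm) (t : V)

/-- **The cell map is compatible with φ-boxes**: `|φ v k − φ w k| ≤ n` for both `k` gives `|ψ v i − ψ w i| ≤ n` for both `i` (`0 ≤ c_i`, `0 < D`,
`c_i·L_i ≤ D`). [cite: MartineauTassion2017, §4.1] -/
theorem ψ_comp (hc₀ : 0 ≤ pr.c₀) (hc₁ : 0 ≤ pr.c₁) (hD : 0 < pr.D) (hL0 : pr.c₀ * pr.L 0 ≤ pr.D) (hL1 : pr.c₁ * pr.L 1 ≤ pr.D) {v w : V} {n : ℤ}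
    (hn : 0 ≤ n) (h0 : |φ v 0 - φ w 0| ≤ n) (h1 : |φ v 1 - φ w 1| ≤ n) (i : Fin 2) : |pr.ψ φ t v i - pr.ψ φ t w i| ≤ n := by
  rw [L_zero] at hL0; rw [L_one] at hL1
  have hL0' : pr.c₀ * (|pr.A| * (|pr.vβ| + |pr.vα|) * n) ≤ n * pr.D := by
    rw [add_comm] at hL0; nlinarith [mul_le_mul_of_nonneg_right hL0 hn]
  have hL1' : pr.c₁ * (|pr.A| * (|pr.n| + |pr.h|) * n) ≤ n * pr.D := by nlinarith [mul_le_mul_of_nonneg_right hL1 hn]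
  have h := fine_containment t hD hc₀ hc₁ hL0' hL1' h0 h1 (s₀ := pr.D / 2) (s₁ := pr.D / 2)
  obtain rfl | rfl : i = 0 ∨ i = 1 := by fin_cases i <;> simp
  · exact h.1
  · exact h.2

/-- **The face frame is compatible with φ-boxes** (sharp form): `|φ v k − φ w k| ≤ n` for both `k` gives `|frame v i − frame w i| ≤ n` for both `i`.
[this work] -/
theorem frame_comp' (hc₀ : 0 ≤ pr.c₀) (hc₁ : 0 ≤ pr.c₁) (hD : 0 < pr.D) (hL0 : pr.c₀ * pr.L 0 ≤ pr.D) (hL1 : pr.c₁ * pr.L 1 ≤ pr.D) (I b : Fin 2)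
    {v w : V} {n : ℤ} (hn : 0 ≤ n) (h0 : |φ v 0 - φ w 0| ≤ n) (h1 : |φ v 1 - φ w 1| ≤ n) (i : Fin 2) :
    |pr.frame φ t I b v i - pr.frame φ t I b w i| ≤ n := by
  by_cases hi : i = I
  · subst hi
    rw [frame_apply_lv, frame_apply_lv]
    exact pr.ψ_comp t hc₀ hc₁ hD hL0 hL1 hn h0 h1 i
  · rw [eq_oth_of_ne hi, frame_apply_raw, frame_apply_raw, relφ_apply, relφ_apply,
      show φ v b - φ t b - (φ w b - φ t b) = φ v b - φ w b by ring]
    obtain rfl | rfl : b = 0 ∨ b = 1 := by fin_cases b <;> simp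
    · exact h0
    · exact h1

/-- **The `hcomp` hypothesis of p1-g11's `kitClauseA` for the face frame**: `φ v − φ w ∈ box 2 n ⇒ |frame v i − frame w i| ≤ n + 1`.
[cite: KozmaNitzan2024, §4 Lemma 10 Step IV (p. 21)] -/
theorem frame_comp (hc₀ : 0 ≤ pr.c₀) (hc₁ : 0 ≤ pr.c₁) (hD : 0 < pr.D) (hL0 : pr.c₀ * pr.L 0 ≤ pr.D) (hL1 : pr.c₁ * pr.L 1 ≤ pr.D) (I b : Fin 2) :
    ∀ (v w : V) (n : ℕ), φ v - φ w ∈ box 2 n → ∀ i, |pr.frame φ t I b v i - pr.frame φ t I b w i| ≤ n + 1 := by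
  intro v w n h i
  rw [mem_box] at h
  have hk : ∀ k, |φ v k - φ w k| ≤ (n : ℤ) := fun k => by
    have := h k; simp only [Pi.sub_apply] at this; exact abs_le.2 ⟨this.1, this.2⟩
  have := pr.frame_comp' t hc₀ hc₁ hD hL0 hL1 I b (Int.natCast_nonneg n) (hk 0) (hk 1) i
  linarith

end FinePrm

end Skelφ

end Summit.CriticalPhenomena.PercolationContinuityZ3.Theorems.Transplant
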